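import Mathlib.NumberTheory.NumberField.Basic
import Mathlib.RingTheory.Norm.Basic
import Mathlib.NumberTheory.NumberField.Norm
import HarnessLib

/-!
# Divisibility of natural numbers is decided in the ring of integers; the similitude scalar divides the square of the Serre presentation scalar
# ([Neukirch1999] Ch. I §2 (2.6): the norm is multiplicative and `N(a) = a^n` for `a ∈ ℤ`)

Topic `NumberTheory/NumberFields`, namespace `Literature.NumberTheory.NumberFields`.  THEOREMS ONLY (no definition, no named fact, no instance, no notation, no
`sorry`).  Cell `hodgecm-mathlib`, P6 «MOD», line L3 (socket `stub_FROB`, COVER road A): the XS arithmetic input `hk : n * k = N ^ 2` of ★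
`FrobeniusCoverSpecialFibre.exists_frobCover_specialFibre` (Q-COV-λ): with `N ∈ 𝔞` (★ `natCast_mem_of_quasiInverse` for the Serre presentation of `𝔞`), `N ∈ 𝔟`
(`𝔟 = c • 𝔞`, `c` fixing `ℕ`) and the norm equation `(n) = 𝔞 · 𝔟` (spine `twistNorm_spec`), `N² ∈ 𝔞𝔟 = (n)`, so `n ∣ N²` in `𝓞 F`, hence in `ℕ` (norms:
`n^d ∣ N^{2d}`).  HC_CM is proved only modulo the printed citations until rung 0 closes; generic, count-neutral.

## References
* [Neukirch1999] J. Neukirch, *Algebraic Number Theory* (1999), Ch. I §2, Prop. (2.6) and p. 8 (multiplicativity of the norm; `N_{K|ℚ}(a) = a^n` for `a ∈ ℚ`).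
-/

set_option autoImplicit false

namespace Literature.NumberTheory.NumberFields

open NumberField

/-- **Divisibility of natural numbers is decided in `𝓞 F`**: `(a : 𝓞 F) ∣ (b : 𝓞 F) → a ∣ b` (take norms to `ℤ`: `a^d ∣ b^d` with `d = [F : ℚ] ≠ 0`).
[cite: Neukirch1999, Ch. I §2 Prop. (2.6) (p. 8)] -/
theorem natCast_dvd_natCast_of_ringOfIntegers_dvd {F : Type*} [Field F] [NumberField F] {a b : ℕ}
    (h : (a : 𝓞 F) ∣ (b : 𝓞 F)) : a ∣ b := by
  obtain ⟨y, hy⟩ := h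
  have hd : Module.finrank ℤ (𝓞 F) ≠ 0 := by
    rw [RingOfIntegers.rank]
    exact Module.finrank_pos.ne'
  have ha : Algebra.norm ℤ ((a : ℕ) : 𝓞 F) = (a : ℤ) ^ Module.finrank ℤ (𝓞 F) := by
    have h1 := Algebra.norm_algebraMap (S := 𝓞 F) (a : ℤ)
    rwa [map_natCast] at h1
  have hb : Algebra.norm ℤ ((b : ℕ) : 𝓞 F) = (b : ℤ) ^ Module.finrank ℤ (𝓞 F) := by
    have h1 := Algebra.norm_algebraMap (S := 𝓞 F) (b : ℤ)
    rwa [map_natCast] at h1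
  have hdvd : (a : ℤ) ^ Module.finrank ℤ (𝓞 F) ∣ (b : ℤ) ^ Module.finrank ℤ (𝓞 F) := by
    refine ⟨Algebra.norm ℤ y, ?_⟩
    rw [← ha, ← hb, hy, map_mul]
  exact Int.natCast_dvd_natCast.mp ((Int.pow_dvd_pow_iff hd).mp hdvd)

/-- **THE SIMILITUDE SCALAR DIVIDES THE SQUARE OF THE PRESENTATION SCALAR**: for ideals `𝔞, 𝔟 ⊆ 𝓞 F` with `(n) = 𝔞 · 𝔟` and a natural number `N ∈ 𝔞 ∩ 𝔟`,
`n ∣ N²` — in the form `∃ k, n * k = N ^ 2` consumed by ★ `exists_frobCover_specialFibre` (`𝔞` the twist ideal with Serre presentation scalar `N ∈ 𝔞`,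
`𝔟 = c • 𝔞 ∋ N`, `n` the twist norm). [cite: Neukirch1999, Ch. I §2 Prop. (2.6) (p. 8)] -/
theorem exists_mul_eq_sq_of_span_eq_mul {F : Type*} [Field F] [NumberField F] {𝔞 𝔟 : Ideal (𝓞 F)} {n N : ℕ}
    (ha : (N : 𝓞 F) ∈ 𝔞) (hb : (N : 𝓞 F) ∈ 𝔟) (h : Ideal.span {(n : 𝓞 F)} = 𝔞 * 𝔟) : ∃ k : ℕ, n * k = N ^ 2 := by
  have hmem : ((N ^ 2 : ℕ) : 𝓞 F) ∈ Ideal.span {(n : 𝓞 F)} := by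
    rw [h, Nat.cast_pow, sq]
    exact Ideal.mul_mem_mul ha hb
  obtain ⟨k, hk⟩ := natCast_dvd_natCast_of_ringOfIntegers_dvd (F := F) (Ideal.mem_span_singleton.mp hmem)
  exact ⟨k, hk.symm⟩

end Literature.NumberTheory.NumberFields
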